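import Summits.QuantumFields.BalabanUV.Beta.GAN24.CombForcingPairFormSucc
import Summits.QuantumFields.BalabanUV.Beta.GAN24.CombExchangeESectorPairFormAn1
import Summits.QuantumFields.BalabanUV.Beta.GAN24.CombExitFaceCurrentCellTotalsAn1

/-!
# `BalabanUV.Beta.GAN24.CombForcingCrossedValueSucc` — binder row G-an2-4 ∕ (CONV-C), W-slot CT-W, the COMB chart (III′), the FORCING SIDE of the crossed row `hXF (l+1)`: **THE CROSSED
# ORBIT SUM OF THE ff CELL ZERO MODE OF THE COMB E-FRAME FORCING AT LEVEL `j+1` IS, UNCONDITIONALLY AT THE WARD PINS, TWICE THE SCALED SUM OF THE SPINE's TWO CROSSED GREEN's-FUNCTION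
# PAIRINGS `⟨q_(ba), E2_(j+1) q_(ab)⟩_cell` (+ mirror)** — leaf-06 g55's `ForcingCellPairFormSucc.crossed_zmode_forcing_succ(_lit)` AT THE COMB DATA: OWNER gan24-p1 g53's 33-at-the-comb
# `CombForcingPairFormSucc.zmode_combForcing_succ_eq_eeWords` with its `hZ` DISCHARGED by my S `comb_sum_box_current_E_eq_zero'` ⨾ my T4 `CombExchangeESectorLatticeWords.eeWords_eq_pairForm`
# (the explicit pair entries, SAME pattern table as the spine) ⨾ the `if`s decided by `a ≠ b` ⨾ `ring`

NOT IN PRINT; OUR BOOKKEEPING ([folklore] BY NAME; G-an2-4 formalisation swarm, leaf prover `b2b-balaban-gan24-formalise-leaf-01`, gen 87, file U; 0 `def`, 0 cited facts, 0 `def … : Prop`,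
0 sorry).  HONEST FRAMING (cell contract, verbatim): «discharging `BetaPertH` makes Bałaban's UV stability UNCONDITIONAL — a real constructive-QFT result; it is NOT the continuum limit and
NOT the Clay problem.»  HONEST DEPENDENCY (verbatim): «continuum YM on T⁴ ⇐ BetaPertH ∧ nine spine estimates (0/9 proved); BetaPertH ⇐ (D1) ∧ (D4) ∧ CAP+tail; G-an2-4 gates asym, D1 and
NE2/3/4.»

WHAT ([folklore]; `[NeZero Lc]`, `Odd Lc`, `3 ≤ Lc`, the Ward pins, every `d j cΛt cΛ`, all units, scalars `c cB`, ANY border `B` without ff block, `a ≠ b`): §1 **`crossed_zmode_combForcing_succ`**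
(generic `d`; right-hand side = leaf-06's §5 right-hand side BYTE-VERBATIM — the comb chart's forcing-side crossed cell summand at level `j+1` IS the (E) chart's); §2
**`crossed_zmode_combForcing_succ_an1`** — the FORCING SUMMAND (the first four `zmode` terms) of the left side of OWNER g53's W∕W″ binder `hXFs (j+1)` (`d = 3`, units `sfStep Lc (j+1)` ∕ `smStep 3 Lc (j+1)`, scale `Lc⁸·Lc^(2(3+1))`, record
`symTablesAn1S2 3 Lc cΛ`, pins `Lc⁴`, `−Lc⁸∕2`, border `cB • vh₂S`) BYTE-VERBATIM, in closed form.  So in `hXFs (j+1)` the forcing summand is now this explicit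
Green's-function pairing (the member-side crossed zero mode and the member's `Lc⁴`-weighted four-face excess stay as they are) — a VALUE row (leaf-03's crossed ledger ∕ Engine C E1), NOT evaluated and NOT claimed here.  Asserts NO value of Bałaban's tables beyond an2's ∕ an1's
DEFINED ones; NEVER «G-an2-4 closed» as (CONV-C); NOT D1, NOT `BetaPertH`, NOT continuum, NOT Clay.  2026-08-27; no existing file touched.
-/

noncomputable section

open Finset
open scoped BigOperators
open Literature.MathematicalPhysics.QuantumFieldTheory
open Literature.MathematicalPhysics.QuantumFieldTheory.Balaban1983to89
open Literature.MathematicalPhysics.QuantumFieldTheory.Balaban1983to89.Beta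
open ExpKernelCalculus (Site MKer comp shiftK Decays BiLoc VertexFamily)
open OneStepResolventKernel (Fib LocStencil decays_mono biLoc_mono)
open OneStepKernelFamily (KInvStep vertexOfK)
open SecondOrderResponse (dM W2SymOfK vertexFamily_dM)
open BalabanStepJetsSucc (mmRead wE)
open BalabanStepW2 (K3OfK M2Of)
open AffineAveraging (box toSite)
open AveragingContoursRooted (ctr ctrOff ctrOff_mem_box)
open Summit.QuantumFields.BalabanUV.Beta.TameKernelCalculus (trK Loc Spr)
open Summit.QuantumFields.BalabanUV.Beta.AxialDressingRooted (coDressKBmAt)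
open Summit.QuantumFields.BalabanUV.Beta.HessKerDressedUnits (unitK unitS)
open Summit.QuantumFields.BalabanUV.Beta.SecondOrderUnits (unitM unitM₂)
open Summit.QuantumFields.BalabanUV.Beta.SpineRooted (e3OfK)
open Summit.QuantumFields.BalabanUV.Beta.SymSecondOrderTablesAn1 (symTablesAn1S2)
open Summit.QuantumFields.BalabanUV.Beta.CombChartStepJets (GcombSh ScombOf SpureCombOf)
open Summit.QuantumFields.BalabanUV.Beta.SymCorrectorKernel (psiKS)
open Summit.QuantumFields.BalabanUV.Beta.SymCorrectorFace (slotPsiS)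
open Summit.QuantumFields.BalabanUV.Beta.GAN24.BiStencilZeroMode (Tab zmode)
open Summit.QuantumFields.BalabanUV.Beta.GAN24.CombesThomas (sfStep smStep)
open Summit.QuantumFields.BalabanUV.Beta.GAN24.CombTransportedBorder (pos_Lc)
open Summit.QuantumFields.BalabanUV.Beta.GAN24.CombForcingTwoFaceWords (spr_unitK_bm exists_locStencil_transport_S exists_vertexFamily_transport_M exists_locStencilFM_transport_M₂
  loc_dM_bm_transport loc_W2SymOfK_bm_transport)
open Summit.QuantumFields.BalabanUV.Beta.GAN24.CombForcingTransport (zmode_combForcing_eq_bm_transport)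
open Summit.QuantumFields.BalabanUV.Beta.GAN24.CombWWordZero (transportM₂_translate sum_box_tsum_W_word_an1_eq_zero)
open Summit.QuantumFields.BalabanUV.Beta.GAN24.DressedSourceZeroModeWords (zmode_dressedSource_inl_inl_of_summable)
open Summit.QuantumFields.BalabanUV.Beta.GAN24.DressedSourceExchangeWords (summable_right_word summable_left_word)
open Summit.QuantumFields.BalabanUV.Beta.GAN24.WWordRespSummable (summable_twoFace_W2SymOfK_dressedStep_bond)
open Summit.QuantumFields.BalabanUV.Beta.GAN24.ExchangeSlotResum (face_weight_periodic)
open Summit.QuantumFields.BalabanUV.Beta.GAN24.CombChargeAntisymPairForm (pairFormLS_of_pairForm)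
open Summit.QuantumFields.BalabanUV.Beta.GAN24.CombForcingWordsSucc (sum_box_comb_direct_word_succ_eq sum_box_comb_swap_word_succ_eq)

open BalabanStepJetsSucc (E2 wVH)
open Summit.QuantumFields.BalabanUV.Beta.GAN24.CombForcingPairFormSucc (zmode_combForcing_succ_eq_eeWords)
open Summit.QuantumFields.BalabanUV.Beta.GAN24.CombExchangeESectorLatticeWords (eeWords_eq_pairForm)
open Summit.QuantumFields.BalabanUV.Beta.GAN24.CombExitFaceCurrentCellTotalsAn1 (comb_sum_box_current_E_eq_zero')

namespace Summit.QuantumFields.BalabanUV.Beta.GAN24.CombForcingCrossedValueSucc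

variable {d : ℕ} {Lc : ℕ} [NeZero Lc]

/-! ## §1 The forcing-side crossed cell summand at level `j+1`, generic `d`, at the Ward pins -/

/-- [folklore] **THE CROSSED ORBIT SUM OF THE LEVEL-`(j+1)` COMB FORCING's ff CELL ZERO MODE, UNCONDITIONALLY AT THE WARD PINS** (`Odd Lc`, `3 ≤ Lc`; every `d j cΛt cΛ`, all units,
scalars `c cB`, any border `B` without ff block; `a ≠ b`): `X(zmode_Lc b̃′_(j+1))(a,b) = 2·c·κ_j·(Π_j(ba;ab) + Π_j(ab;ba))` with the spine's explicit pairing — leaf-06 §5's right-hand side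
byte-verbatim (OWNER g53's 33-at-the-comb with `hZ := comb_sum_box_current_E_eq_zero'`, four times; my T4 `eeWords_eq_pairForm`, four times; the `if`s decided by `a ≠ b`; `ring`). -/
theorem crossed_zmode_combForcing_succ (hLo : Odd Lc) (hLc : 3 ≤ Lc) (cΛt sf sm cΛ c cB : ℝ) {B : Tab d}
    (hBff : ∀ κ u κ' u' x z (α β : Fin (d + 1)), B κ u κ' u' x z (Sum.inl α) (Sum.inl β) = 0) (j : ℕ) {a b : Fin (d + 1)} (hab : a ≠ b) :
    zmode Lc (fun κ u κ' u' => c • mmRead Lc (K3OfK (unitK sf sm (GcombSh (d := d) Lc (j + 1))) Lc (unitS sf sm (SpureCombOf (symTablesAn1S2 d Lc cΛt) ((Lc : ℝ) ^ (d + 1)) (-((Lc : ℝ) ^ (d + 1) * (1 / 2) * (Lc : ℝ) ^ (d + 1))) cΛ (j + 1)))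
        (unitM sf sm ((symTablesAn1S2 d Lc cΛt).M (j + 1)))
        (W2SymOfK (unitK sf sm (GcombSh (d := d) Lc (j + 1))) Lc (unitS sf sm (SpureCombOf (symTablesAn1S2 d Lc cΛt) ((Lc : ℝ) ^ (d + 1)) (-((Lc : ℝ) ^ (d + 1) * (1 / 2) * (Lc : ℝ) ^ (d + 1))) cΛ (j + 1))) (unitM sf sm ((symTablesAn1S2 d Lc cΛt).M (j + 1))) 0
          (unitM₂ sf sm (M2Of d Lc (symTablesAn1S2 d Lc cΛt).mixFF (j + 1)))) κ u κ' u') + cB • B κ u κ' u') a b (Sum.inl a) (Sum.inl b)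
      + zmode Lc (fun κ u κ' u' => c • mmRead Lc (K3OfK (unitK sf sm (GcombSh (d := d) Lc (j + 1))) Lc (unitS sf sm (SpureCombOf (symTablesAn1S2 d Lc cΛt) ((Lc : ℝ) ^ (d + 1)) (-((Lc : ℝ) ^ (d + 1) * (1 / 2) * (Lc : ℝ) ^ (d + 1))) cΛ (j + 1)))
        (unitM sf sm ((symTablesAn1S2 d Lc cΛt).M (j + 1)))
        (W2SymOfK (unitK sf sm (GcombSh (d := d) Lc (j + 1))) Lc (unitS sf sm (SpureCombOf (symTablesAn1S2 d Lc cΛt) ((Lc : ℝ) ^ (d + 1)) (-((Lc : ℝ) ^ (d + 1) * (1 / 2) * (Lc : ℝ) ^ (d + 1))) cΛ (j + 1))) (unitM sf sm ((symTablesAn1S2 d Lc cΛt).M (j + 1))) 0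
          (unitM₂ sf sm (M2Of d Lc (symTablesAn1S2 d Lc cΛt).mixFF (j + 1)))) κ u κ' u') + cB • B κ u κ' u') b a (Sum.inl a) (Sum.inl b)
      + (zmode Lc (fun κ u κ' u' => c • mmRead Lc (K3OfK (unitK sf sm (GcombSh (d := d) Lc (j + 1))) Lc (unitS sf sm (SpureCombOf (symTablesAn1S2 d Lc cΛt) ((Lc : ℝ) ^ (d + 1)) (-((Lc : ℝ) ^ (d + 1) * (1 / 2) * (Lc : ℝ) ^ (d + 1))) cΛ (j + 1)))
        (unitM sf sm ((symTablesAn1S2 d Lc cΛt).M (j + 1)))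
        (W2SymOfK (unitK sf sm (GcombSh (d := d) Lc (j + 1))) Lc (unitS sf sm (SpureCombOf (symTablesAn1S2 d Lc cΛt) ((Lc : ℝ) ^ (d + 1)) (-((Lc : ℝ) ^ (d + 1) * (1 / 2) * (Lc : ℝ) ^ (d + 1))) cΛ (j + 1))) (unitM sf sm ((symTablesAn1S2 d Lc cΛt).M (j + 1))) 0
          (unitM₂ sf sm (M2Of d Lc (symTablesAn1S2 d Lc cΛt).mixFF (j + 1)))) κ u κ' u') + cB • B κ u κ' u') a b (Sum.inl b) (Sum.inl a)
      + zmode Lc (fun κ u κ' u' => c • mmRead Lc (K3OfK (unitK sf sm (GcombSh (d := d) Lc (j + 1))) Lc (unitS sf sm (SpureCombOf (symTablesAn1S2 d Lc cΛt) ((Lc : ℝ) ^ (d + 1)) (-((Lc : ℝ) ^ (d + 1) * (1 / 2) * (Lc : ℝ) ^ (d + 1))) cΛ (j + 1)))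
        (unitM sf sm ((symTablesAn1S2 d Lc cΛt).M (j + 1)))
        (W2SymOfK (unitK sf sm (GcombSh (d := d) Lc (j + 1))) Lc (unitS sf sm (SpureCombOf (symTablesAn1S2 d Lc cΛt) ((Lc : ℝ) ^ (d + 1)) (-((Lc : ℝ) ^ (d + 1) * (1 / 2) * (Lc : ℝ) ^ (d + 1))) cΛ (j + 1))) (unitM sf sm ((symTablesAn1S2 d Lc cΛt).M (j + 1))) 0
          (unitM₂ sf sm (M2Of d Lc (symTablesAn1S2 d Lc cΛt).mixFF (j + 1)))) κ u κ' u') + cB • B κ u κ' u') b a (Sum.inl b) (Sum.inl a))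
      = 2 * (c * (-((sf * sm * ((((Lc ^ (j + 1 + 1) : ℕ) : ℝ)) ^ (d + 1 + 1))⁻¹) * (sf * sm * ((((Lc ^ (j + 1 + 1) : ℕ) : ℝ)) ^ (d + 1 + 1))⁻¹)) * ((Lc : ℝ) * (Lc : ℝ))) *
          (((box (d + 1) Lc).card : ℝ) * (((Lc : ℝ) * (sm * sf)) * ((((Lc ^ (j + 1 + 1) : ℕ) : ℝ)) ^ (d + 1 + 1))⁻¹) ^ 2 *
          ((((sf * sm)⁻¹ * (sf⁻¹ * sf⁻¹) * ((Lc : ℝ) ^ (d + 1) * wE d Lc (j + 1))) * (-(1 / 2 : ℝ))) * (((sf * sm)⁻¹ * (sf⁻¹ * sf⁻¹) * ((Lc : ℝ) ^ (d + 1) * wE d Lc (j + 1))) * (1 / 2 : ℝ)) *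
            ((sf * sf) * ((wVH d Lc (j + 1))⁻¹ *
              ∑ x ∈ box (d + 1) Lc, ∑ f : Fin (d + 1),
                ((if f = b then ((Lc : ℝ)⁻¹ * (Lc : ℝ)⁻¹) * ((((toSite x a % (Lc : ℤ) : ℤ) : ℝ) - ((Lc : ℝ) - 1) / 2)) else 0)
                  + (if f = a then (-(Lc : ℝ)⁻¹ * ((((toSite x b % (Lc : ℤ) : ℤ) : ℝ) - ((Lc : ℝ) - 1) / 2))) * (if toSite x a % (Lc : ℤ) = (Lc : ℤ) - 1 then (1 : ℝ) else 0) else 0)) *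
                ∑' s : Site (d + 1), ∑ f' : Fin (d + 1), E2 d Lc (j + 1) (toSite x) s (Sum.inl f) (Sum.inl f') *
                  ((if f' = a then ((Lc : ℝ)⁻¹ * (Lc : ℝ)⁻¹) * ((((s b % (Lc : ℤ) : ℤ) : ℝ) - ((Lc : ℝ) - 1) / 2)) else 0)
                    + (if f' = b then (-(Lc : ℝ)⁻¹ * ((((s a % (Lc : ℤ) : ℤ) : ℝ) - ((Lc : ℝ) - 1) / 2))) * (if s b % (Lc : ℤ) = (Lc : ℤ) - 1 then (1 : ℝ) else 0) else 0)))))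
          + ((box (d + 1) Lc).card : ℝ) * (((Lc : ℝ) * (sm * sf)) * ((((Lc ^ (j + 1 + 1) : ℕ) : ℝ)) ^ (d + 1 + 1))⁻¹) ^ 2 *
          ((((sf * sm)⁻¹ * (sf⁻¹ * sf⁻¹) * ((Lc : ℝ) ^ (d + 1) * wE d Lc (j + 1))) * (-(1 / 2 : ℝ))) * (((sf * sm)⁻¹ * (sf⁻¹ * sf⁻¹) * ((Lc : ℝ) ^ (d + 1) * wE d Lc (j + 1))) * (1 / 2 : ℝ)) *
            ((sf * sf) * ((wVH d Lc (j + 1))⁻¹ *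
              ∑ x ∈ box (d + 1) Lc, ∑ f : Fin (d + 1),
                ((if f = a then ((Lc : ℝ)⁻¹ * (Lc : ℝ)⁻¹) * ((((toSite x b % (Lc : ℤ) : ℤ) : ℝ) - ((Lc : ℝ) - 1) / 2)) else 0)
                  + (if f = b then (-(Lc : ℝ)⁻¹ * ((((toSite x a % (Lc : ℤ) : ℤ) : ℝ) - ((Lc : ℝ) - 1) / 2))) * (if toSite x b % (Lc : ℤ) = (Lc : ℤ) - 1 then (1 : ℝ) else 0) else 0)) *
                ∑' s : Site (d + 1), ∑ f' : Fin (d + 1), E2 d Lc (j + 1) (toSite x) s (Sum.inl f) (Sum.inl f') *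
                  ((if f' = b then ((Lc : ℝ)⁻¹ * (Lc : ℝ)⁻¹) * ((((s a % (Lc : ℤ) : ℤ) : ℝ) - ((Lc : ℝ) - 1) / 2)) else 0)
                    + (if f' = a then (-(Lc : ℝ)⁻¹ * ((((s b % (Lc : ℤ) : ℤ) : ℝ) - ((Lc : ℝ) - 1) / 2))) * (if s a % (Lc : ℤ) = (Lc : ℤ) - 1 then (1 : ℝ) else 0) else 0))))))) := by
  have hba : b ≠ a := fun h => hab h.symm
  have hZ := comb_sum_box_current_E_eq_zero' (d := d) hLo hLc cΛt sf sm cΛ j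
  rw [zmode_combForcing_succ_eq_eeWords cΛt sf sm ((Lc : ℝ) ^ (d + 1)) (-((Lc : ℝ) ^ (d + 1) * (1 / 2) * (Lc : ℝ) ^ (d + 1))) cΛ c cB hBff j hZ,
    zmode_combForcing_succ_eq_eeWords cΛt sf sm ((Lc : ℝ) ^ (d + 1)) (-((Lc : ℝ) ^ (d + 1) * (1 / 2) * (Lc : ℝ) ^ (d + 1))) cΛ c cB hBff j hZ,
    zmode_combForcing_succ_eq_eeWords cΛt sf sm ((Lc : ℝ) ^ (d + 1)) (-((Lc : ℝ) ^ (d + 1) * (1 / 2) * (Lc : ℝ) ^ (d + 1))) cΛ c cB hBff j hZ,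
    zmode_combForcing_succ_eq_eeWords cΛt sf sm ((Lc : ℝ) ^ (d + 1)) (-((Lc : ℝ) ^ (d + 1) * (1 / 2) * (Lc : ℝ) ^ (d + 1))) cΛ c cB hBff j hZ,
    eeWords_eq_pairForm cΛt sf sm ((Lc : ℝ) ^ (d + 1) * wE d Lc (j + 1)) cΛ j,
    eeWords_eq_pairForm cΛt sf sm ((Lc : ℝ) ^ (d + 1) * wE d Lc (j + 1)) cΛ j,
    eeWords_eq_pairForm cΛt sf sm ((Lc : ℝ) ^ (d + 1) * wE d Lc (j + 1)) cΛ j,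
    eeWords_eq_pairForm cΛt sf sm ((Lc : ℝ) ^ (d + 1) * wE d Lc (j + 1)) cΛ j,
    if_pos (Or.inl rfl : a = a ∨ b = b), if_pos (Or.inl rfl : b = b ∨ a = a),
    if_neg (not_or.mpr ⟨hba, hab⟩ : ¬(b = a ∨ a = b)), if_neg (not_or.mpr ⟨hab, hba⟩ : ¬(a = b ∨ b = a))]
  ring

/-! ## §2 an1's `d = 3` literal — the forcing summand of `hXFs (j+1)` in closed form -/

/-- [folklore] **THE FORCING SUMMAND OF THE OWNER's `hXFs (j+1)` IN CLOSED FORM** (its first four `zmode` terms, tokens byte-verbatim) (`d = 3`, units `sfStep Lc (j+1)` ∕ `smStep 3 Lc (j+1)`, scale `Lc⁸·Lc^(2(3+1))`, record `symTablesAn1S2 3 Lc cΛ`,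
pins `cE = Lc⁴`, `cVH = −Lc⁸∕2`, border `cB • (symTablesAn1S2 3 Lc cΛ).vh₂S`; `Odd Lc`, `3 ≤ Lc`, every `j cΛ cB`, `a ≠ b`). -/
theorem crossed_zmode_combForcing_succ_an1 (hLo : Odd Lc) (hLc : 3 ≤ Lc) (cΛ cB : ℝ) (j : ℕ) {a b : Fin (3 + 1)} (hab : a ≠ b) :
    zmode Lc (fun κ u κ' u' => ((Lc : ℝ) ^ 8 * (Lc : ℝ) ^ (2 * (3 + 1))) • mmRead Lc (K3OfK (unitK (sfStep Lc (j + 1)) (smStep 3 Lc (j + 1)) (GcombSh (d := 3) Lc (j + 1))) Lc (unitS (sfStep Lc (j + 1)) (smStep 3 Lc (j + 1)) (SpureCombOf (symTablesAn1S2 3 Lc cΛ) ((Lc : ℝ) ^ 4) (-((Lc : ℝ) ^ 8 / 2)) cΛ (j + 1))) (unitM (sfStep Lc (j + 1)) (smStep 3 Lc (j + 1)) ((symTablesAn1S2 3 Lc cΛ).M (j + 1))) (W2SymOfK (unitK (sfStep Lc (j + 1)) (smStep 3 Lc (j + 1)) (GcombSh (d := 3) Lc (j + 1))) Lc (unitS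 (sfStep Lc (j + 1)) (smStep 3 Lc (j + 1)) (SpureCombOf (symTablesAn1S2 3 Lc cΛ) ((Lc : ℝ) ^ 4) (-((Lc : ℝ) ^ 8 / 2)) cΛ (j + 1))) (unitM (sfStep Lc (j + 1)) (smStep 3 Lc (j + 1)) ((symTablesAn1S2 3 Lc cΛ).M (j + 1))) 0 (unitM₂ (sfStep Lc (j + 1)) (smStep 3 Lc (j + 1)) (M2Of 3 Lc (symTablesAn1S2 3 Lc cΛ).mixFF (j + 1)))) κ u κ' u') + cB • (symTablesAn1S2 3 Lc cΛ).vh₂S κ u κ' u') a b (Sum.inl a) (Sum.inl b)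
      + zmode Lc (fun κ u κ' u' => ((Lc : ℝ) ^ 8 * (Lc : ℝ) ^ (2 * (3 + 1))) • mmRead Lc (K3OfK (unitK (sfStep Lc (j + 1)) (smStep 3 Lc (j + 1)) (GcombSh (d := 3) Lc (j + 1))) Lc (unitS (sfStep Lc (j + 1)) (smStep 3 Lc (j + 1)) (SpureCombOf (symTablesAn1S2 3 Lc cΛ) ((Lc : ℝ) ^ 4) (-((Lc : ℝ) ^ 8 / 2)) cΛ (j + 1))) (unitM (sfStep Lc (j + 1)) (smStep 3 Lc (j + 1)) ((symTablesAn1S2 3 Lc cΛ).M (j + 1))) (W2SymOfK (unitK (sfStep Lc (j + 1)) (smStep 3 Lc (j + 1)) (GcombSh (d := 3) Lc (j + 1))) Lc (unitS (sfStep Lc (j + 1)) (smStep 3 Lc (j + 1)) (SpureCombOf (symTablesAn1S2 3 Lc cΛ) ((Lc : ℝ) ^ 4) (-((Lc : ℝ) ^ 8 / 2)) cΛ (j + 1))) (unitM (sfStep Lc (j + 1)) (smStep 3 Lc (j + 1)) ((symTablesAn1S2 3 Lc cΛ).M (j + 1))) 0 (unitM₂ (sfStep Lc (j + 1)) (smStep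 3 Lc (j + 1)) (M2Of 3 Lc (symTablesAn1S2 3 Lc cΛ).mixFF (j + 1)))) κ u κ' u') + cB • (symTablesAn1S2 3 Lc cΛ).vh₂S κ u κ' u') b a (Sum.inl a) (Sum.inl b)
      + (zmode Lc (fun κ u κ' u' => ((Lc : ℝ) ^ 8 * (Lc : ℝ) ^ (2 * (3 + 1))) • mmRead Lc (K3OfK (unitK (sfStep Lc (j + 1)) (smStep 3 Lc (j + 1)) (GcombSh (d := 3) Lc (j + 1))) Lc (unitS (sfStep Lc (j + 1)) (smStep 3 Lc (j + 1)) (SpureCombOf (symTablesAn1S2 3 Lc cΛ) ((Lc : ℝ) ^ 4) (-((Lc : ℝ) ^ 8 / 2)) cΛ (j + 1))) (unitM (sfStep Lc (j + 1)) (smStep 3 Lc (j + 1)) ((symTablesAn1S2 3 Lc cΛ).M (j + 1))) (W2SymOfK (unitK (sfStep Lc (j + 1)) (smStep 3 Lc (j + 1)) (GcombSh (d := 3) Lc (j + 1))) Lc (unitS (sfStep Lc (j + 1)) (smStep 3 Lc (j + 1)) (SpureCombOf (symTablesAn1S2 3 Lc cΛ) ((Lc : ℝ) ^ 4) (-((Lc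 : ℝ) ^ 8 / 2)) cΛ (j + 1))) (unitM (sfStep Lc (j + 1)) (smStep 3 Lc (j + 1)) ((symTablesAn1S2 3 Lc cΛ).M (j + 1))) 0 (unitM₂ (sfStep Lc (j + 1)) (smStep 3 Lc (j + 1)) (M2Of 3 Lc (symTablesAn1S2 3 Lc cΛ).mixFF (j + 1)))) κ u κ' u') + cB • (symTablesAn1S2 3 Lc cΛ).vh₂S κ u κ' u') a b (Sum.inl b) (Sum.inl a)
      + zmode Lc (fun κ u κ' u' => ((Lc : ℝ) ^ 8 * (Lc : ℝ) ^ (2 * (3 + 1))) • mmRead Lc (K3OfK (unitK (sfStep Lc (j + 1)) (smStep 3 Lc (j + 1)) (GcombSh (d := 3) Lc (j + 1))) Lc (unitS (sfStep Lc (j + 1)) (smStep 3 Lc (j + 1)) (SpureCombOf (symTablesAn1S2 3 Lc cΛ) ((Lc : ℝ) ^ 4) (-((Lc : ℝ) ^ 8 / 2)) cΛ (j + 1))) (unitM (sfStep Lc (j + 1)) (smStep 3 Lc (j + 1)) ((symTablesAn1S2 3 Lc cΛ).M (j + 1))) (W2SymOfK (unitK (sfStep Lc (j + 1)) (smStep 3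 Lc (j + 1)) (GcombSh (d := 3) Lc (j + 1))) Lc (unitS (sfStep Lc (j + 1)) (smStep 3 Lc (j + 1)) (SpureCombOf (symTablesAn1S2 3 Lc cΛ) ((Lc : ℝ) ^ 4) (-((Lc : ℝ) ^ 8 / 2)) cΛ (j + 1))) (unitM (sfStep Lc (j + 1)) (smStep 3 Lc (j + 1)) ((symTablesAn1S2 3 Lc cΛ).M (j + 1))) 0 (unitM₂ (sfStep Lc (j + 1)) (smStep 3 Lc (j + 1)) (M2Of 3 Lc (symTablesAn1S2 3 Lc cΛ).mixFF (j + 1)))) κ u κ' u') + cB • (symTablesAn1S2 3 Lc cΛ).vh₂S κ u κ' u') b a (Sum.inl b) (Sum.inl a))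
      = 2 * (((Lc : ℝ) ^ 8 * (Lc : ℝ) ^ (2 * (3 + 1))) * (-(((sfStep Lc (j + 1)) * (smStep 3 Lc (j + 1)) * ((((Lc ^ (j + 1 + 1) : ℕ) : ℝ)) ^ (3 + 1 + 1))⁻¹) * ((sfStep Lc (j + 1)) * (smStep 3 Lc (j + 1)) * ((((Lc ^ (j + 1 + 1) : ℕ) : ℝ)) ^ (3 + 1 + 1))⁻¹)) * ((Lc : ℝ) * (Lc : ℝ))) *
          (((box (3 + 1) Lc).card : ℝ) * (((Lc : ℝ) * ((smStep 3 Lc (j + 1)) * (sfStep Lc (j + 1)))) * ((((Lc ^ (j + 1 + 1) : ℕ) : ℝ)) ^ (3 + 1 + 1))⁻¹) ^ 2 *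
          (((((sfStep Lc (j + 1)) * (smStep 3 Lc (j + 1)))⁻¹ * ((sfStep Lc (j + 1))⁻¹ * (sfStep Lc (j + 1))⁻¹) * ((Lc : ℝ) ^ 4 * wE 3 Lc (j + 1))) * (-(1 / 2 : ℝ))) * ((((sfStep Lc (j + 1)) * (smStep 3 Lc (j + 1)))⁻¹ * ((sfStep Lc (j + 1))⁻¹ * (sfStep Lc (j + 1))⁻¹) * ((Lc : ℝ) ^ 4 * wE 3 Lc (j + 1))) * (1 / 2 : ℝ)) *
            (((sfStep Lc (j + 1)) * (sfStep Lc (j + 1))) * ((wVH 3 Lc (j + 1))⁻¹ *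
              ∑ x ∈ box (3 + 1) Lc, ∑ f : Fin (3 + 1),
                ((if f = b then ((Lc : ℝ)⁻¹ * (Lc : ℝ)⁻¹) * ((((toSite x a % (Lc : ℤ) : ℤ) : ℝ) - ((Lc : ℝ) - 1) / 2)) else 0)
                  + (if f = a then (-(Lc : ℝ)⁻¹ * ((((toSite x b % (Lc : ℤ) : ℤ) : ℝ) - ((Lc : ℝ) - 1) / 2))) * (if toSite x a % (Lc : ℤ) = (Lc : ℤ) - 1 then (1 : ℝ) else 0) else 0)) *
                ∑' s : Site (3 + 1), ∑ f' : Fin (3 + 1), E2 3 Lc (j + 1) (toSite x) s (Sum.inl f) (Sum.inl f') *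
                  ((if f' = a then ((Lc : ℝ)⁻¹ * (Lc : ℝ)⁻¹) * ((((s b % (Lc : ℤ) : ℤ) : ℝ) - ((Lc : ℝ) - 1) / 2)) else 0)
                    + (if f' = b then (-(Lc : ℝ)⁻¹ * ((((s a % (Lc : ℤ) : ℤ) : ℝ) - ((Lc : ℝ) - 1) / 2))) * (if s b % (Lc : ℤ) = (Lc : ℤ) - 1 then (1 : ℝ) else 0) else 0)))))
          + ((box (3 + 1) Lc).card : ℝ) * (((Lc : ℝ) * ((smStep 3 Lc (j + 1)) * (sfStep Lc (j + 1)))) * ((((Lc ^ (j + 1 + 1) : ℕ) : ℝ)) ^ (3 + 1 + 1))⁻¹) ^ 2 *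
          (((((sfStep Lc (j + 1)) * (smStep 3 Lc (j + 1)))⁻¹ * ((sfStep Lc (j + 1))⁻¹ * (sfStep Lc (j + 1))⁻¹) * ((Lc : ℝ) ^ 4 * wE 3 Lc (j + 1))) * (-(1 / 2 : ℝ))) * ((((sfStep Lc (j + 1)) * (smStep 3 Lc (j + 1)))⁻¹ * ((sfStep Lc (j + 1))⁻¹ * (sfStep Lc (j + 1))⁻¹) * ((Lc : ℝ) ^ 4 * wE 3 Lc (j + 1))) * (1 / 2 : ℝ)) *
            (((sfStep Lc (j + 1)) * (sfStep Lc (j + 1))) * ((wVH 3 Lc (j + 1))⁻¹ *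
              ∑ x ∈ box (3 + 1) Lc, ∑ f : Fin (3 + 1),
                ((if f = a then ((Lc : ℝ)⁻¹ * (Lc : ℝ)⁻¹) * ((((toSite x b % (Lc : ℤ) : ℤ) : ℝ) - ((Lc : ℝ) - 1) / 2)) else 0)
                  + (if f = b then (-(Lc : ℝ)⁻¹ * ((((toSite x a % (Lc : ℤ) : ℤ) : ℝ) - ((Lc : ℝ) - 1) / 2))) * (if toSite x b % (Lc : ℤ) = (Lc : ℤ) - 1 then (1 : ℝ) else 0) else 0)) *
                ∑' s : Site (3 + 1), ∑ f' : Fin (3 + 1), E2 3 Lc (j + 1) (toSite x) s (Sum.inl f) (Sum.inl f') *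
                  ((if f' = b then ((Lc : ℝ)⁻¹ * (Lc : ℝ)⁻¹) * ((((s a % (Lc : ℤ) : ℤ) : ℝ) - ((Lc : ℝ) - 1) / 2)) else 0)
                    + (if f' = a then (-(Lc : ℝ)⁻¹ * ((((s b % (Lc : ℤ) : ℤ) : ℝ) - ((Lc : ℝ) - 1) / 2))) * (if s a % (Lc : ℤ) = (Lc : ℤ) - 1 then (1 : ℝ) else 0) else 0))))))) := by
  have h := crossed_zmode_combForcing_succ (d := 3) hLo hLc cΛ (sfStep Lc (j + 1)) (smStep 3 Lc (j + 1)) cΛ ((Lc : ℝ) ^ 8 * (Lc : ℝ) ^ (2 * (3 + 1))) cB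
    (B := (symTablesAn1S2 3 Lc cΛ).vh₂S) (fun _ _ _ _ _ _ _ _ => rfl) j hab
  have e1 : -((Lc : ℝ) ^ (3 + 1) * (1 / 2) * (Lc : ℝ) ^ (3 + 1)) = -((Lc : ℝ) ^ 8 / 2) := by ring
  have e2 : ((Lc : ℝ) ^ (3 + 1)) = (Lc : ℝ) ^ 4 := by norm_num
  rw [e1, e2] at h
  exact h

end Summit.QuantumFields.BalabanUV.Beta.GAN24.CombForcingCrossedValueSucc

end
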